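import Summits.AtomisticToContinuum.HydrodynamicLimit.Theorems.OneFlightGossipEngineEnergyCurrentTailsLevelCensusSplitFloorRung0Statics
import HarnessLib

/-!
# Crux `EnergyCurrentTails` (stmt-AtomisticToContinuum-9235), line `quartic-schur-ledger`, rung-0 certificate of T′:
# H2, the 3-label statics `firstPartnerRung0_excess` (helper file, `--supports stmt-AtomisticToContinuum-9235`)

Fix `N + 1` hard spheres of diameter `ε = ε_N = hsDiameter σ N` on `𝕋³ × ℝ³`, a window `h > 0`, and the ordered
would-be pairs `W = wouldBePairs ε h w` of a configuration `w` (pairs whose FREE flights come within `ε` during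
`(0, h]`).  The OUT-DEGREE-`≥ 2` COUNT `#{p ∈ W : ∃ q ∈ W, q.1 = p.1, q ≠ p}` (would-be pairs `(a, b)` whose first
particle `a` has a second would-be partner `c ≠ b`) is the error term of the pathwise transfer H1
(`firstPartnerRung0_pathwise`) from the band tube sum to the first-partner sum.  THIS FILE: under the homogeneous
drifted Gibbs law `G_N = localGibbsLaw σ a u θ N Φ` (constant profiles, small density) it has a measurable majorant
`M` on the hard-sphere domain with

  `E_{G_N}[M] ≤ 4096 · (N+1)³ · ε⁴ h² (‖u‖² + 3θ)`,

which is `N`-UNIFORM PER PARTICLE at the mesoscopic look-ahead `h = κ ε_N` (`(N+1)³ ε_N⁶ κ² = κ² σ⁶ (N+1)`).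

**Proof.**  (1) Combinatorics (`card_filter_le_sum₃`): `p = (a, b)` with witness `q = (a, c)` yields a pairwise
distinct triple `(a, b, c)` with `(a, b), (a, c) ∈ W`, so the count is at most the triple sum of the indicators of
"`(a, b) ∈ W` and `(a, c) ∈ W`".  (2) Geometry: a would-be pair of a non-overlapping configuration puts a lattice
lift of the minimal image of the relative position into the forward swept tube of the relative velocity
(`RateFloorNoBursts.exists_latticeVec_mem_of_wouldBe`, `exists_sweptTube`, volume `≤ 4ε²h‖v‖`), so the indicator
is dominated by that of the measurable event `A a b ∩ B a c` of c2's `splitFloorRung0_statics`.  (3) Statics: each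
of the `≤ (N+1)³` events is a three-label event with shared first label, of probability
`≤ 256 ε⁴ h² · E‖w − v‖² ≤ 1024 ε⁴ h² (‖u‖² + 3θ)` (`ShortFlightCount.measure_windowEvent_inter_tubeEvent_le` fed
with Ruelle's canonical three-label bound `posGibbs_tripleEvent_le` and the Gaussian moment
`EvenStressEnskog.lintegral_relSpeed_sq_le`).  `1024 ≤ 4096`.

References: D. Ruelle, *Statistical Mechanics: Rigorous Results* (1969) §4.2; C. Cercignani, R. Illner,
M. Pulvirenti, *The Mathematical Theory of Dilute Gases* (1994) §2.2; elementary counting.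
-/

noncomputable section

open scoped BigOperators Classical ENNReal InnerProductSpace
open MeasureTheory Set
open Literature.Analysis.FluidPDE Literature.MathematicalPhysics.KineticTheory
  Literature.MathematicalPhysics.StatisticalMechanics

namespace Summit.AtomisticToContinuum.HydrodynamicLimit.Theorems

namespace QuarticSchurLedger

open Literature.Analysis.FunctionSpaces RateFloorLine RateFloorNoBursts EnergyCurrentTailsLevelCensus

/-! ## Combinatorics: the out-degree-`≥ 2` count against a triple indicator sum -/

/-- **Counting the out-degree-`≥ 2` pairs by triples.**  If every pair `p` of `W` admitting another pair of `W`
with the same first component has a witness `c` with `1 ≤ f p.1 p.2 c` (`f ≥ 0` in `ℝ≥0∞`), then the number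
of such pairs is at most `Σ_a Σ_b Σ_c f a b c`. [folklore] -/
theorem card_filter_le_sum₃ {n : ℕ} (W : Finset (Fin n × Fin n)) (f : Fin n → Fin n → Fin n → ℝ≥0∞)
    (hf : ∀ p : Fin n × Fin n, p ∈ W.filter (fun p => ∃ q ∈ W, q.1 = p.1 ∧ q ≠ p) → ∃ c, 1 ≤ f p.1 p.2 c) :
    (((W.filter fun p => ∃ q ∈ W, q.1 = p.1 ∧ q ≠ p).card : ℕ) : ℝ≥0∞) ≤ ∑ a, ∑ b, ∑ c, f a b c := by
  set F := W.filter fun p => ∃ q ∈ W, q.1 = p.1 ∧ q ≠ p with hF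
  calc ((F.card : ℕ) : ℝ≥0∞) = ∑ _p ∈ F, (1 : ℝ≥0∞) := by
        rw [Finset.sum_const, nsmul_eq_mul, mul_one]
    _ ≤ ∑ p ∈ F, ∑ c, f p.1 p.2 c := Finset.sum_le_sum fun p hp => by
        obtain ⟨c, hc⟩ := hf p hp
        exact hc.trans (Finset.single_le_sum (f := fun c => f p.1 p.2 c) (fun _ _ => bot_le) (Finset.mem_univ c))
    _ ≤ ∑ p : Fin n × Fin n, ∑ c, f p.1 p.2 c := Finset.sum_le_sum_of_subset (Finset.subset_univ F)
    _ = ∑ a, ∑ b, ∑ c, f a b c := Fintype.sum_prod_type _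

/-! ## The registered helper: a measurable majorant of the out-degree-`≥ 2` count, `O((N+1)³ ε⁴ h²)` in mean -/

-- adapted from `EnergyCurrentTailsLevelCensus.splitFloorRung0_statics` (c2): same events, three-label part
-- only, with the `(N+1)³` bookkeeping of `card_filter_le_sum₃` instead of the crude `(N+1)⁴ · 𝟙{D ≠ 0}`.
/-- **H2 · 3-label statics: the out-degree-≥-2 would-be count is second order, N-uniformly per particle.**
For constant profiles, small density, every flow, window `h > 0`: the number of ordered would-be pairs
`p ∈ W_h(w)` admitting another would-be pair with the same first particle has a measurable majorant `M` on the
hard-sphere domain with `E_{G_N}[M] ≤ 4096 (N+1)³ ε_N⁴ h² (‖u‖² + 3θ)`. [folklore] -/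
theorem firstPartnerRung0_excess : ∀ (σ : ℝ), 0 < σ → σ ≤ 1 / 2 → SmallDensity uniformProfile σ → ∀ (a θ : ℝ), 0 < a → 0 < θ → ∀ (u : V3) (N : ℕ) (Φ : HardSphereFlow (Torus.geometry (Fin 3)) (hsDiameter σ N) (N + 1)) (h : ℝ), 0 < h → ∃ M : Config (N + 1) (Fin 3) T3 → ℝ≥0∞, Measurable M ∧ (∀ w ∈ hardSphereDomain (Torus.geometry (Fin 3)) (N + 1) (hsDiameter σ N), ((((wouldBePairs (hsDiameter σ N) h w).filter fun p => ∃ q ∈ wouldBePairs (hsDiameter σ N) h w, q.1 = p.1 ∧ q ≠ p).card : ℕ) : ℝ≥0∞) ≤ M w) ∧ ∫⁻ w, M w ∂(localGibbsLaw σ (fun _ => a) (fun _ => u) (fun _ => θ) N Φ) ≤ ENNReal.ofReal (4096 * (((N + 1 : ℕ) : ℝ) ^ 3 * (hsDiameter σ N ^ 4 * h ^ 2 * (‖u‖ ^ 2 + 3 * θ)))) := by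
  intro σ hσ hσ2 hsm a θ ha hθ u N Φ h hh
  have hε0 : 0 < hsDiameter σ N := hsDiameter_pos hσ N
  set P := localGibbsLaw σ (fun _ => a) (fun _ => u) (fun _ => θ) N Φ with hPdef
  -- the swept tube of window `h` and its velocity flip
  obtain ⟨S, hSm, hSvol, hS⟩ := exists_sweptTube (h := h) hε0 hh.le
  set Sn : V3 → Set V3 := fun v => S (-v) with hSn
  have hSnm : MeasurableSet {q : V3 × V3 | q.1 ∈ Sn q.2} :=
    hSm.preimage (measurable_fst.prodMk measurable_snd.neg)
  have hSnvol : ∀ v, volume (Sn v) ≤ ENNReal.ofReal (4 * (hsDiameter σ N) ^ 2 * h * ‖v‖) := fun v => by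
    simpa only [hSn, norm_neg] using hSvol (-v)
  have hlift : ∀ B : Set V3, MeasurableSet B →
      volume {x : T3 | ∃ k : Fin 3 → ℤ, Torus.reprSym x + Torus.latticeVec k ∈ B} ≤ volume B :=
    fun B hB => by simpa only [sub_zero] using volume_setOf_exists_reprSym_add_latticeVec_mem_le 0 hB
  -- the events
  set A : Fin (N + 1) → Fin (N + 1) → Set (Config (N + 1) (Fin 3) T3) := fun p m =>
    {w | ∃ k : Fin 3 → ℤ, Torus.reprSym ((w m).1 - (w p).1) + Torus.latticeVec k ∈ Sn ((w p).2 - (w m).2)}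
    with hAdef
  set B : Fin (N + 1) → Fin (N + 1) → Set (Config (N + 1) (Fin 3) T3) := fun p j' =>
    {w | ∃ k : Fin 3 → ℤ, Torus.reprSym ((w j').1 - (w p).1) + Torus.latticeVec k ∈
      S ((w j').2 - (w p).2) ∪ Sn ((w p).2 - (w j').2)} with hBdef
  have hψm : ∀ (i j i' j'' : Fin (N + 1)) (k : Fin 3 → ℤ), Measurable fun w : Config (N + 1) (Fin 3) T3 =>
      (Torus.reprSym ((w i).1 - (w j).1) + Torus.latticeVec k, (w i').2 - (w j'').2) := fun i j i' j'' k =>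
    ((Torus.measurable_reprSym.comp ((measurable_pi_apply i).fst.sub (measurable_pi_apply j).fst)).add_const
      _).prodMk ((measurable_pi_apply i').snd.sub (measurable_pi_apply j'').snd)
  have hAm : ∀ p m, MeasurableSet (A p m) := fun p m => by
    have h1 : A p m = ⋃ k : Fin 3 → ℤ, (fun w : Config (N + 1) (Fin 3) T3 =>
        (Torus.reprSym ((w m).1 - (w p).1) + Torus.latticeVec k, (w p).2 - (w m).2)) ⁻¹'
          {q : V3 × V3 | q.1 ∈ Sn q.2} := by
      ext w; simp only [hAdef, Set.mem_setOf_eq, Set.mem_iUnion, Set.mem_preimage]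
    exact h1 ▸ MeasurableSet.iUnion fun k => hSnm.preimage (hψm m p p m k)
  have hBm : ∀ p j', MeasurableSet (B p j') := fun p j' => by
    have h2 : B p j' = ⋃ k : Fin 3 → ℤ, ((fun w : Config (N + 1) (Fin 3) T3 =>
          (Torus.reprSym ((w j').1 - (w p).1) + Torus.latticeVec k, (w j').2 - (w p).2)) ⁻¹'
            {q : V3 × V3 | q.1 ∈ S q.2} ∪
          (fun w : Config (N + 1) (Fin 3) T3 =>
            (Torus.reprSym ((w j').1 - (w p).1) + Torus.latticeVec k, (w p).2 - (w j').2)) ⁻¹'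
            {q : V3 × V3 | q.1 ∈ Sn q.2}) := by
      ext w; simp only [hBdef, Set.mem_setOf_eq, Set.mem_iUnion, Set.mem_preimage, Set.mem_union]
    exact h2 ▸ MeasurableSet.iUnion fun k => (hSm.preimage (hψm j' p j' p k)).union (hSnm.preimage (hψm j' p p j' k))
  -- the three-label statics
  set M₂ := ∫⁻ q, ENNReal.ofReal (‖q.2 - q.1‖ ^ 2) ∂((gaussMeasure u θ).prod (gaussMeasure u θ)) with hM₂
  have hM₂le : M₂ ≤ ENNReal.ofReal (4 * (‖u‖ ^ 2 + 3 * θ)) := EvenStressEnskog.lintegral_relSpeed_sq_le u hθ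
  set c : ℝ := 256 * (hsDiameter σ N) ^ 4 * h ^ 2 * (4 * (‖u‖ ^ 2 + 3 * θ)) with hc
  have hkey3 : ∀ p m j' : Fin (N + 1), p ≠ m → p ≠ j' → m ≠ j' → P (A p m ∩ B p j') ≤ ENNReal.ofReal c := by
    intro p m j' hpm hpj hmj
    refine (measure_windowEvent_inter_tubeEvent_le hσ2 ha hθ u Φ hpm hpj (fun T T' hT hT' =>
      posGibbs_tripleEvent_le hsm hpm hpj hmj hT hT') hh.le hh.le hSnm hSm hSnvol hSvol hlift).trans ?_
    rw [hc, ENNReal.ofReal_mul (by positivity : (0 : ℝ) ≤ 256 * (hsDiameter σ N) ^ 4 * h ^ 2),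
      show 128 * hsDiameter σ N ^ 4 * h * (h + h) = 256 * hsDiameter σ N ^ 4 * h ^ 2 by ring]
    gcongr
  -- covering: would-be pairs put the configuration in the events
  have hcovA : ∀ w ∈ hardSphereDomain (Torus.geometry (Fin 3)) (N + 1) (hsDiameter σ N), ∀ p m : Fin (N + 1),
      (m, p) ∈ wouldBePairs (hsDiameter σ N) h w → w ∈ A p m := by
    intro w hw p m hmp
    obtain ⟨hne, hwb⟩ := (mem_wouldBePairs_iff (hsDiameter σ N) h w (m, p)).1 hmp
    obtain ⟨k, hk⟩ := exists_latticeVec_mem_of_wouldBe hS hw hne hwb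
    refine ⟨k, ?_⟩
    show Torus.reprSym ((w m).1 - (w p).1) + Torus.latticeVec k ∈ S (-((w p).2 - (w m).2))
    exact (neg_sub (w p).2 (w m).2).symm ▸ hk
  have hcovB : ∀ w ∈ hardSphereDomain (Torus.geometry (Fin 3)) (N + 1) (hsDiameter σ N), ∀ p j' : Fin (N + 1),
      (j', p) ∈ wouldBePairs (hsDiameter σ N) h w → w ∈ B p j' := by
    intro w hw p j' hjp
    obtain ⟨hne, hwb⟩ := (mem_wouldBePairs_iff (hsDiameter σ N) h w (j', p)).1 hjp
    obtain ⟨k, hk⟩ := exists_latticeVec_mem_of_wouldBe hS hw hne hwb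
    exact ⟨k, Or.inl hk⟩
  -- the static majorant: the triple indicator sum
  set f₃ : Fin (N + 1) → Fin (N + 1) → Fin (N + 1) → Config (N + 1) (Fin 3) T3 → ℝ≥0∞ := fun p m j' w =>
    if p ≠ m ∧ p ≠ j' ∧ m ≠ j' then (A p m ∩ B p j').indicator 1 w else 0 with hf₃
  have hf₃m : ∀ p m j', Measurable (f₃ p m j') := fun p m j' => by
    by_cases hcd : p ≠ m ∧ p ≠ j' ∧ m ≠ j'
    · simp only [hf₃, if_pos hcd]; exact measurable_one.indicator ((hAm p m).inter (hBm p j'))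
    · simp only [hf₃, if_neg hcd]; exact measurable_const
  have hMm : Measurable fun w => ∑ p, ∑ m, ∑ j', f₃ p m j' w :=
    Finset.measurable_sum _ fun p _ => Finset.measurable_sum _ fun m _ => Finset.measurable_sum _ fun j' _ => hf₃m p m j'
  refine ⟨fun w => ∑ p, ∑ m, ∑ j', f₃ p m j' w, hMm, ?_, ?_⟩
  · -- the count against the triple sum
    intro w hw
    refine card_filter_le_sum₃ _ (fun p m j' => f₃ p m j' w) fun p hp => ?_
    rw [Finset.mem_filter] at hp
    obtain ⟨hpW, q, hqW, hq1, hqp⟩ := hp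
    obtain ⟨a', b⟩ := p
    obtain ⟨a'', c'⟩ := q
    simp only at hq1
    subst hq1
    have hab : a'' ≠ b := ((mem_wouldBePairs_iff (hsDiameter σ N) h w (a'', b)).1 hpW).1
    have hac : a'' ≠ c' := ((mem_wouldBePairs_iff (hsDiameter σ N) h w (a'', c')).1 hqW).1
    have hbc : b ≠ c' := fun hbc => hqp (by rw [hbc])
    have hwA : w ∈ A a'' b := hcovA w hw a'' b ((mem_wouldBePairs_symm (hsDiameter σ N) h w a'' b).1 hpW)
    have hwB : w ∈ B a'' c' := hcovB w hw a'' c' ((mem_wouldBePairs_symm (hsDiameter σ N) h w a'' c').1 hqW)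
    refine ⟨c', le_of_eq ?_⟩
    simp only [hf₃, if_pos (And.intro hab (And.intro hac hbc)), Set.indicator_of_mem (Set.mem_inter hwA hwB),
      Pi.one_apply]
  · -- the mean
    have hterm : ∀ p m j', ∫⁻ w, f₃ p m j' w ∂P ≤ ENNReal.ofReal c := fun p m j' => by
      by_cases hcd : p ≠ m ∧ p ≠ j' ∧ m ≠ j'
      · simp only [hf₃, if_pos hcd]
        rw [lintegral_indicator_one ((hAm p m).inter (hBm p j'))]
        exact hkey3 p m j' hcd.1 hcd.2.1 hcd.2.2
      · simp only [hf₃, if_neg hcd, lintegral_const, zero_mul, zero_le]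
    have hn : ((N + 1 : ℕ) : ℝ≥0∞) = ENNReal.ofReal ((N + 1 : ℕ) : ℝ) := (ENNReal.ofReal_natCast _).symm
    have hcnn : 0 ≤ ((N + 1 : ℕ) : ℝ) ^ 3 * (hsDiameter σ N ^ 4 * h ^ 2 * (‖u‖ ^ 2 + 3 * θ)) := by positivity
    calc ∫⁻ w, ∑ p, ∑ m, ∑ j', f₃ p m j' w ∂P = ∑ p, ∑ m, ∑ j', ∫⁻ w, f₃ p m j' w ∂P := by
          rw [lintegral_finsetSum _ fun p _ => Finset.measurable_sum _ fun m _ =>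
            Finset.measurable_sum _ fun j' _ => hf₃m p m j']
          refine Finset.sum_congr rfl fun p _ => ?_
          rw [lintegral_finsetSum _ fun m _ => Finset.measurable_sum _ fun j' _ => hf₃m p m j']
          exact Finset.sum_congr rfl fun m _ => lintegral_finsetSum _ fun j' _ => hf₃m p m j'
      _ ≤ ∑ _p : Fin (N + 1), ∑ _m : Fin (N + 1), ∑ _j' : Fin (N + 1), ENNReal.ofReal c := by
          gcongr with p _ m _ j' _
          exact hterm p m j'
      _ = ((N + 1 : ℕ) : ℝ≥0∞) ^ 3 * ENNReal.ofReal c := by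
          simp only [Finset.sum_const, Finset.card_univ, Fintype.card_fin, nsmul_eq_mul]; ring
      _ = ENNReal.ofReal (((N + 1 : ℕ) : ℝ) ^ 3 * c) := by
          rw [hn, ← ENNReal.ofReal_pow (Nat.cast_nonneg _), ← ENNReal.ofReal_mul (by positivity)]
      _ ≤ ENNReal.ofReal (4096 * (((N + 1 : ℕ) : ℝ) ^ 3 * (hsDiameter σ N ^ 4 * h ^ 2 * (‖u‖ ^ 2 + 3 * θ)))) := by
          refine ENNReal.ofReal_le_ofReal ?_
          rw [hc]
          nlinarith [hcnn]

end QuarticSchurLedger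

end Summit.AtomisticToContinuum.HydrodynamicLimit.Theorems

end
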